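import Mathlib
import HarnessLib

/-!
# The lattice dictionary: `m ∣ ξ / d ⟺ φ ≡ ψ (mod m)` for some `ψ ⊥_w φ`
(stub `stub_latticeDepth_dvd_iff` of line `Sketch`, crux `EisensteinQuarantine`, stmt-ABC-15023)

Pure algebra over `ℤ`.  For a finite index type `ι`, weights `w : ι → ℕ`, a vector `φ : ι → ℤ`
and `m : ℤ`, put `f_i := w_i φ_i`, `d := gcd_i f_i` (`Finset.univ.gcd`, normalised, so `d ≥ 0`)
and `ξ := Σ_i w_i φ_i² = Σ_i f_i φ_i`.  Then

  `m ∣ ξ / d  ⟺  ∃ ψ : ι → ℤ, Σ_i w_i ψ_i φ_i = 0 ∧ ∀ i, m ∣ φ_i - ψ_i`,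

i.e. the depth of `ξ / d` at `m` is the depth to which `φ` occurs, modulo `m`, inside its own
`w`-orthogonal complement.

Proof.  Write `f_i = d c_i` (`Finset.gcd_dvd`), so `ξ = d · Σ_i c_i φ_i`.
* If `d = 0` then every `f_i = 0`, `ξ / d = ξ / 0 = 0` and `ψ := φ` is a witness
  (`Σ w_i φ_i φ_i = Σ f_i φ_i = 0`); both sides hold.
* If `d ≠ 0` then `ξ / d = t := Σ_i c_i φ_i` (`Int.mul_ediv_cancel_left`).
  (→) Bezout for `Finset.gcd` over `ℤ` (`Finset.gcd_eq_sum_mul`): `d = Σ_i f_i g_i` for some `g`.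
  Put `ψ_i := φ_i - t g_i`; then `Σ w_i ψ_i φ_i = ξ - t Σ f_i g_i = d t - t d = 0` and
  `φ_i - ψ_i = t g_i` is divisible by `m ∣ t`.
  (←) From `Σ w_i ψ_i φ_i = d Σ c_i ψ_i = 0` and `d ≠ 0` get `Σ c_i ψ_i = 0`, hence
  `t = Σ_i c_i (φ_i - ψ_i)` is a sum of multiples of `m`.
-/

-- `Summit.<Summit>.<Problem>`: for the single-conjunct summit `ABC` the duplicate `ABC.ABC` is mandated.
set_option linter.dupNamespace false

namespace Summit.ABC.ABC.Theorems

namespace EisensteinQuarantineLatticeDepth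

/-- **The dictionary with the gcd abstracted.**  If `d ≠ 0`, `w_i φ_i = d c_i` for all `i`, and
`d = Σ_i w_i φ_i g_i` (a Bezout representation), then
`m ∣ (Σ_i w_i φ_i²) / d ⟺ ∃ ψ, Σ_i w_i ψ_i φ_i = 0 ∧ ∀ i, m ∣ φ_i - ψ_i`. -/
theorem dvd_div_iff_of_bezout {ι : Type*} [Fintype ι] (w : ι → ℕ) (φ : ι → ℤ) (m : ℤ) {d : ℤ}
    (hd0 : d ≠ 0) (c g : ι → ℤ) (hc : ∀ i, (w i : ℤ) * φ i = d * c i)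
    (hg : d = ∑ i, (w i : ℤ) * φ i * g i) :
    m ∣ (∑ i, (w i : ℤ) * φ i ^ 2) / d ↔
      ∃ ψ : ι → ℤ, ∑ i, (w i : ℤ) * ψ i * φ i = 0 ∧ ∀ i, m ∣ φ i - ψ i := by
  -- `ξ = d · Σ c_i φ_i`, so `ξ / d = Σ c_i φ_i`
  have hξ : ∑ i, (w i : ℤ) * φ i ^ 2 = d * ∑ i, c i * φ i := by
    rw [Finset.mul_sum]
    exact Finset.sum_congr rfl fun i _ => by rw [pow_two, ← mul_assoc, hc i, mul_assoc]
  rw [hξ, Int.mul_ediv_cancel_left _ hd0]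
  constructor
  · -- (→): `ψ := φ - t • g`, `t := Σ c_i φ_i`
    intro hm
    refine ⟨fun i => φ i - (∑ j, c j * φ j) * g i, ?_, fun i => ?_⟩
    · calc ∑ i, (w i : ℤ) * (φ i - (∑ j, c j * φ j) * g i) * φ i
          = ∑ i, (w i : ℤ) * φ i ^ 2 - (∑ j, c j * φ j) * ∑ i, (w i : ℤ) * φ i * g i := by
            rw [Finset.mul_sum, ← Finset.sum_sub_distrib]
            exact Finset.sum_congr rfl fun i _ => by ring
        _ = 0 := by rw [hξ, ← hg]; ring
    · rw [sub_sub_cancel]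
      exact hm.mul_right _
  · -- (←): `Σ c_i ψ_i = 0`, so `Σ c_i φ_i = Σ c_i (φ_i - ψ_i)`
    rintro ⟨ψ, hψ, hm⟩
    have h1 : d * ∑ i, c i * ψ i = 0 := by
      rw [← hψ, Finset.mul_sum]
      exact Finset.sum_congr rfl fun i _ => by
        rw [← mul_assoc, ← hc i, mul_right_comm]
    have h2 : ∑ i, c i * ψ i = 0 := (mul_eq_zero.mp h1).resolve_left hd0
    have h3 : ∑ i, c i * φ i = ∑ i, c i * (φ i - ψ i) := by
      rw [eq_comm, ← sub_zero (∑ i, c i * φ i), ← h2, ← Finset.sum_sub_distrib]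
      exact Finset.sum_congr rfl fun i _ => by ring
    rw [h3]
    exact Finset.dvd_sum fun i _ => (hm i).mul_left _

end EisensteinQuarantineLatticeDepth

open EisensteinQuarantineLatticeDepth

/-- **The lattice dictionary** (`First lemma` of the occurrence-depth line).  For weights
`w : ι → ℕ`, `φ : ι → ℤ`, `m : ℤ`, with `d := gcd_i (w_i φ_i)` and `ξ := Σ_i w_i φ_i²`:
`m ∣ ξ / d ⟺ ∃ ψ : ι → ℤ, Σ_i w_i ψ_i φ_i = 0 ∧ ∀ i, m ∣ φ_i - ψ_i` — the depth of `ξ / d` at `m`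
is the depth to which `φ` occurs modulo `m` in its `w`-orthogonal complement.  Bezout for
`Finset.gcd` over `ℤ` (`Finset.gcd_eq_sum_mul`); the degenerate case `d = 0` (all `w_i φ_i = 0`,
`ξ = 0`, `ξ / 0 = 0`) holds on both sides with `ψ := φ`. -/
theorem stub_latticeDepth_dvd_iff {ι : Type*} [Fintype ι] (w : ι → ℕ) (φ : ι → ℤ) (m : ℤ) :
    m ∣ (∑ i, (w i : ℤ) * φ i ^ 2) / Finset.univ.gcd (fun i => (w i : ℤ) * φ i) ↔
      ∃ ψ : ι → ℤ, ∑ i, (w i : ℤ) * ψ i * φ i = 0 ∧ ∀ i, m ∣ φ i - ψ i := by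
  classical
  -- `d ∣ w_i φ_i`: write `w_i φ_i = d c_i`
  have hdf : ∀ i, Finset.univ.gcd (fun i => (w i : ℤ) * φ i) ∣ (w i : ℤ) * φ i :=
    fun i => Finset.gcd_dvd (Finset.mem_univ i)
  choose c hc using hdf
  by_cases hd0 : Finset.univ.gcd (fun i => (w i : ℤ) * φ i) = 0
  · -- degenerate case: all `w_i φ_i = 0`, `ξ / 0 = 0`, witness `ψ := φ`
    have hf0 : ∀ i, (w i : ℤ) * φ i = 0 := fun i => by rw [hc i, hd0, zero_mul]
    rw [hd0, Int.ediv_zero]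
    refine iff_of_true (dvd_zero m) ⟨φ, ?_, fun i => by rw [sub_self]; exact dvd_zero m⟩
    exact Finset.sum_eq_zero fun i _ => by rw [hf0 i, zero_mul]
  · -- Bezout for `Finset.gcd` over `ℤ`
    obtain ⟨g, hg⟩ :
        ∃ g : ι → ℤ, Finset.univ.gcd (fun i => (w i : ℤ) * φ i) = ∑ i, (w i : ℤ) * φ i * g i :=
      Finset.gcd_eq_sum_mul _ _
    exact dvd_div_iff_of_bezout w φ m hd0 c g hc hg

end Summit.ABC.ABC.Theorems
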